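import Literature.MathematicalPhysics.QuantumFieldTheory.Balaban1983to89.B9WalkLettersCoordsS
import Literature.MathematicalPhysics.QuantumFieldTheory.Balaban1983to89.B9CoReadingCoordsTranspose
import Literature.MathematicalPhysics.QuantumFieldTheory.Balaban1983to89.B9Thm31SiteGsqBoundsReg335Y
import Literature.MathematicalPhysics.QuantumFieldTheory.Balaban1983to89.B9PinMembersKLevelV1

/-!
# `Balaban1983to89.B9WalkLettersGsqTranspose` — the pinned local inverse `G′_□(U)` IS ITS OWN TRANSPOSE: the kinematic letter `IsTransposePair (Gsq U □) (Gsq U □)`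
# at node00-def-Y's pin `gsqcoS x (trBasis N) … (parSymY …) □ U` (the first of the three letter transposes of the ₃ faces)

T. Bałaban, *Propagators for lattice gauge theories in a background field*, Commun. Math. Phys. **99** (1985) 389–434 [`Balaban1985BackgroundPropagators`, "B9"],
Thm 3.11 p. 416 (*"G′_□ … symmetric"*), (3.79) p. 406, (3.87) p. 409, p. 391 (transposes); T. Bałaban, *Propagators and renormalization transformations for lattice
gauge theories. II*, Commun. Math. Phys. **96** (1984) 223–250 [`Balaban1984PropagatorsII`], (2.51) p. 232.

statement-level skeleton of published theorems with citation tags; proofs where landed; nothing here is a claim about the Yang–Mills mass gap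

WHY THIS FILE (cell `pub-ymgap`, node N06 [B9]; width seat `pub-ymgap-dag-n06-w1` g5).  The ₃ faces of the N06 census (`B9RWSumsAllBlocksPairMDir3`,
`B9RWSumsDefinitePinsPairMDir3(Rows)`) replace the third-order schema `FactorsL2Second37Dir` by three kinematic letter transposes, the first of which is
`∀ □, IsTransposePair ((𝔬 x).Gsq U □) ((𝔬 x).Gsq U □)`.  The certificate PINS `(𝔬 x).Gsq U □ = gsqcoS x (trBasis N) (bg9Y … x) (fun U => U) (parSymY x.toKIdx) □ U`
(binder `hGsqF` of `Summit…N06AtOpsYNuOfRecordV6EPairNT`), and `gsqcoS` is def-Y's coordinate model `GcoS` of the site operator `GsqY … (parSymY …) (cubeDomY x □)`,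
which is trace-symmetric at every `G`-valued background, `G ≤ U(N)` (dag-n06-w1 g3 `B9Thm31SiteGsqBoundsReg335Y.isSymmTr_GsqY_parSymY`); dag-n06-j∕def-Y's
`B9CoReadingCoordsTranspose.isTransposePair_GcoS_trBasis` turns trace-symmetry into `IsTransposePair` over the trace basis.  THIS FILE composes the two:
§1 the model form (any `B`, `cfg`, `G`-valued `cfg U`), §2 the member forms at `bg9Y (Matrix (Fin N) (Fin N) ℂ) G x` from `Reg335` (which carries «U has
values in G», p. 396), and the `∀ □` bundle the knit hands to the ₃ faces after `rw [hGsqF]`.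

HONEST SCOPE.  Regime-free kinematics (no (3.35) smallness is used beyond `G`-valuedness); nothing of [B9]'s estimates asserted; COUNT-NEUTRAL; N06 NOT
discharged; K1⁹ NOT closed; the YM mass gap (Clay) is NOT proved by any of this — R4 closes the conditional finite-𝕋⁴ rung `BalabanLadder.UV` only.
-/

namespace Literature.MathematicalPhysics.QuantumFieldTheory.Balaban1983to89.B9WalkLettersGsqTranspose

open Literature.MathematicalPhysics.QuantumFieldTheory.Balaban1983to89
open Node00 B6KLevelCensusIndexV1 B6Cover236MultiLevelBlocks B9PinMembersKLevelV1 B9BackgroundsKLevelV1 B9Thm37Glue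
open B9CoReadingCoordsTranspose B9WalkLettersCoordsS B9Thm31SiteGsqBoundsReg335Y B9CoReadingCoordsS Node00.OpsYLocalInverse
open scoped Matrix Matrix.Norms.L2Operator

noncomputable section

variable {d ℓ : ℕ} {hd : 1 ≤ d + 1} {hL : Odd (ℓ + 1) ∧ 1 < ℓ + 1} {b₀ b₁ : ℝ} {Mstar : ℕ} {N : ℕ}
  {G : Subgroup (Matrix (Fin N) (Fin N) ℂ)ˣ}

/-! ## §1 The model form -/

/-- ★ **`G′_□(U)ᵀ = G′_□(U)` FOR THE PINNED COORDINATE MODEL**: `gsqcoS x (trBasis N) B cfg (parSymY …) □ U` is its own transpose whenever `cfg U` is `G`-valued with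
`G ≤ U(N)`. [cite: Balaban1985BackgroundPropagators, Thm 3.11 p.416 («symmetric»), (3.79) p.406, (3.87) p.409; Balaban1984PropagatorsII, (2.51) p.232] -/
theorem isTransposePair_gsqcoS_parSymY (x : MemberY d ℓ hd hL b₀ b₁ Mstar) (hG : G ≤ B7Prop2Explicit.unitaryUnits (Matrix (Fin N) (Fin N) ℂ))
    (B : B9.Backgrounds) (cfg : B.Cfg → CfgY (Matrix (Fin N) (Fin N) ℂ) x.toKIdx) (U : B.Cfg) (hU : ∀ μ z, cfg U μ z ∈ G)
    (c : ↥(cubes x.toKIdx.D.toDomains)) :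
    IsTransposePair (gsqcoS x (trBasis N) B cfg (parSymY x.toKIdx) c U) (gsqcoS x (trBasis N) B cfg (parSymY x.toKIdx) c U) := by
  unfold gsqcoS
  exact isTransposePair_GcoS_trBasis x.toKIdx B cfg (GsqY x.toKIdx (parSymY x.toKIdx) (cubeDomY x c)) U
    (isSymmTr_GsqY_parSymY x.toKIdx hG hU (cubeDomY x c))

/-! ## §2 The member forms at `bg9Y` -/

/-- ★ **AT A MEMBER'S OWN BACKGROUNDS `bg9Y (M_N(ℂ)) G x`, IDENTITY READING, `G`-VALUED `U`.** [cite: Balaban1985BackgroundPropagators, Thm 3.11 p.416, p.396 («U has values in G»)] -/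
theorem isTransposePair_gsqcoS_parSymY_bg9Y (x : MemberY d ℓ hd hL b₀ b₁ Mstar) (hG : G ≤ B7Prop2Explicit.unitaryUnits (Matrix (Fin N) (Fin N) ℂ))
    (U : (bg9Y (Matrix (Fin N) (Fin N) ℂ) G x).Cfg) (hU : ∀ μ z, U μ z ∈ G) (c : ↥(cubes x.toKIdx.D.toDomains)) :
    IsTransposePair (gsqcoS x (trBasis N) (bg9Y (Matrix (Fin N) (Fin N) ℂ) G x) (fun U => U) (parSymY x.toKIdx) c U)
      (gsqcoS x (trBasis N) (bg9Y (Matrix (Fin N) (Fin N) ℂ) G x) (fun U => U) (parSymY x.toKIdx) c U) :=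
  isTransposePair_gsqcoS_parSymY x hG (bg9Y (Matrix (Fin N) (Fin N) ℂ) G x) (fun U => U) U hU c

/-- ★★ **THE SAME UNDER THE CERTIFICATE'S PREMISS `(bg9Y … x).Reg335 c α₀ U`** (its first clause is «U is `G`-valued»).
[cite: Balaban1985BackgroundPropagators, (3.35) p.396, Thm 3.11 p.416] -/
theorem isTransposePair_gsqcoS_parSymY_of_reg335Y (x : MemberY d ℓ hd hL b₀ b₁ Mstar) (hG : G ≤ B7Prop2Explicit.unitaryUnits (Matrix (Fin N) (Fin N) ℂ))
    {c₀ α₀ : ℝ} {U : (bg9Y (Matrix (Fin N) (Fin N) ℂ) G x).Cfg} (hU : (bg9Y (Matrix (Fin N) (Fin N) ℂ) G x).Reg335 c₀ α₀ U)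
    (c : ↥(cubes x.toKIdx.D.toDomains)) :
    IsTransposePair (gsqcoS x (trBasis N) (bg9Y (Matrix (Fin N) (Fin N) ℂ) G x) (fun U => U) (parSymY x.toKIdx) c U)
      (gsqcoS x (trBasis N) (bg9Y (Matrix (Fin N) (Fin N) ℂ) G x) (fun U => U) (parSymY x.toKIdx) c U) :=
  isTransposePair_gsqcoS_parSymY_bg9Y x hG U (mem_of_reg335 x.toKIdx ((reg335Y_iff x c₀ α₀ U).1 hU).1) c

/-- ★★ **THE KNIT'S BUNDLE**: for an `Ops` letter family whose `Gsq` is PINNED to the model (the certificate's `hGsqF`), the first transpose letter of the ₃ faces,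
`∀ □, IsTransposePair ((𝔬).Gsq U □) ((𝔬).Gsq U □)`, at every (3.35)-regular `U`. [cite: Balaban1985BackgroundPropagators, Thm 3.11 p.416, (3.87) p.409, p.391] -/
theorem gsq_transpose_of_pin (x : MemberY d ℓ hd hL b₀ b₁ Mstar) (hG : G ≤ B7Prop2Explicit.unitaryUnits (Matrix (Fin N) (Fin N) ℂ))
    (Gsq : (bg9Y (Matrix (Fin N) (Fin N) ℂ) G x).Cfg → ↥(cubes x.toKIdx.D.toDomains) → Module.End ℝ (XSK (TrIdx N) x.toKIdx → ℝ))
    (hGsqF : ∀ (U : (bg9Y (Matrix (Fin N) (Fin N) ℂ) G x).Cfg) (c : ↥(cubes x.toKIdx.D.toDomains)),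
      Gsq U c = gsqcoS x (trBasis N) (bg9Y (Matrix (Fin N) (Fin N) ℂ) G x) (fun U => U) (parSymY x.toKIdx) c U)
    {c₀ α₀ : ℝ} {U : (bg9Y (Matrix (Fin N) (Fin N) ℂ) G x).Cfg} (hU : (bg9Y (Matrix (Fin N) (Fin N) ℂ) G x).Reg335 c₀ α₀ U) :
    ∀ c, IsTransposePair (Gsq U c) (Gsq U c) := fun c => by
  rw [hGsqF]
  exact isTransposePair_gsqcoS_parSymY_of_reg335Y x hG hU c

end

end Literature.MathematicalPhysics.QuantumFieldTheory.Balaban1983to89.B9WalkLettersGsqTranspose
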